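import Literature.NumberTheory.IwasawaTheory.ClassicalMuVanishesKleinDescentNoGrowth
import HarnessLib

set_option autoImplicit false

/-!
# Ferrero–Washington leaves the Cartan μ-descents: `μ(L) = 0` from `μ(L^{⟨s⟩}) = 0` and `μ = 0` for the QUADRATIC
# subfields not fixed by `s` (`D₄ = N_s(3)` and `SD₁₆ = N_ns(3)` shapes), no growth theorem, no named fact

Topic `NumberTheory/IwasawaTheory` (namespace = path).  THEOREM-ONLY file (no definition, no named fact, no `sorry`), written by
the prover seat `bsd-potss-k8t-c4` g23 (cell `bsd-potss`; μ-road of stmt-BirchSwinnertonDyer-19982; closes nothing).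

The census forms `classicalMuVanishes_of_isCyclotomic_of_kuroda_rat` (D₄) and `…_semidihedral_rat'` / `…_semidihedral_kuroda_rat`
(SD₁₆) of the tree (seats `bsd-potss-conjA-anchor` g11, `bsd-potss-k8t-c4` g22) take `ferreroWashington1979_classicalMuVanishes` (a
named fact, XL) and use it at exactly two places: the biquadratic field `B = L^{⟨z⟩}` (resp. `L^{⟨w⟩}`) and one quadratic field inside
`L^{⟨s⟩}`.  CHARACTER COUNT (Washington §13.1 / Brauer–Kuroda relations, `p ∤ #G`): every irreducible character of `G = D₄` resp.
`SD₁₆` occurs in the permutation character of `G/⟨s⟩` (`s` a non-central involution) EXCEPT the two linear characters `χ` with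
`χ(s) = −1`, whose kernels are the two index-`2` subgroups NOT containing `s`.  Hence `μ(L) = 0` follows from `μ(L^{⟨s⟩}) = 0` together
with `μ = 0` for the (at most two) QUADRATIC subfields `L^H`, `[G : H] = 2`, `s ∉ H` — by the tree's kernel-certified Klein norm relation
`2 = N_⟨u⟩ + N_⟨v⟩ − u·N_⟨uv⟩` (`classicalMuVanishes_restrict_of_klein_four'`, hI-free) used twice (once in `Gal(B/ℚ) ≅ C₂ × C₂`, once in
`G`) and the `p`-prime-index descent `classicalMuVanishes_of_isCyclotomic_of_tower'`.  For `L = ℚ(E[3])` and `s` = complex conjugation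
these two quadratic fields are the IMAGINARY quadratic subfields `ℚ(√−3)` and `K⁻`; their `μ = 0` is a finite class-group certificate
(Iwasawa 1956 / Fukuda 1994, both tree theorems), so Ferrero–Washington is no longer needed on the `p = 3` Cartan μ-roads.

* §1 `classicalMuVanishes_of_isCyclotomic_of_klein_four_inputs'` — Klein four `{1,u,v,uv} ≤ Gal(L/F)`, THREE inputs
  `μ(L^{⟨u⟩}) = μ(L^{⟨v⟩}) = μ(L^{⟨uv⟩}) = 0` ⟹ `μ(L) = 0` (no conjugacy hypothesis, no growth theorem, no named fact).
* §2 `finrank_fixedField_eq_index`, `classicalMuVanishes_fixedField_of_quotient_klein'` — `N ⊴ G` with `[G : N] = 4`, `a, b ∈ G` with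
  `a², b², [a,b] ∈ N`, `a, b, ab ∉ N`: `μ(L^N) = 0` from `μ(L^{⟨b⟩}) = 0` and «`μ(L^H) = 0` for every `H ≥ N` of index `2` with `b ∉ H`».
* §3 `classicalMuVanishes_of_isCyclotomic_of_dihedral_rat_of_quadratic` — the `D₄` census form over `ℚ`, FW-free.
* §4 `classicalMuVanishes_of_isCyclotomic_of_semidihedral_rat_of_quadratic` — the `SD₁₆` census form over `ℚ`, FW-free.
* §5 `classicalMuVanishes_of_isCyclotomic_of_card_two_of_quadratic`, `…_of_card_four_of_quadratic` — the degenerate (abelian) images.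

References: [Washington1997] §13.1 (μ under extensions), §7.5; [BiasseEtAl2022] Example 2.5, Prop. 3.7 (Klein norm relation);
[Lemmermeyer1994] §1; [MilneFT2022] Ch. 3 (fundamental theorem); [Serre1972] §2.2.
-/

noncomputable section

open scoped NumberField

open Field IntermediateField Literature.NumberTheory.GaloisRepresentations Literature.NumberTheory.EllipticCurves
  Literature.NumberTheory.EllipticCurves.ZpExtension Literature.NumberTheory.NumberFields

namespace Literature.NumberTheory.IwasawaTheory

variable {F : Type} [Field F] [NumberField F] {p : ℕ} [Fact p.Prime]

/-! ### §0 Small helpers -/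

omit [NumberField F] [Fact p.Prime] in
/-- `p ∤ [E : F]` for an intermediate field `E` of `L/F` when `p ∤ [L : F]`. [folklore] -/
private theorem not_dvd_finrank_intermediateField₀ {L : Type} [Field L] [Algebra F L] [FiniteDimensional F L]
    (hp : ¬ p ∣ Module.finrank F L) (E : IntermediateField F L) : ¬ p ∣ Module.finrank F ↥E := fun h =>
  hp (h.trans (Dvd.intro _ (Module.finrank_mul_finrank F ↥E L)))

omit [NumberField F] in
/-- For `N ⊴ Gal(L/F)`, `N ≤ H`, `M = L^N`: the fixed field in `M` of the image of `H` in `Gal(M/F)` lifts to `L^H`.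
[cite: MilneFT2022, Ch. 3 (fundamental theorem)] -/
private theorem lift_fixedField_eq_of_map_restrictNormalHom₀ {L : Type} [Field L] [Algebra F L] [FiniteDimensional F L]
    [IsGalois F L] (N H : Subgroup (L ≃ₐ[F] L)) [N.Normal] (hNH : N ≤ H)
    (H' : Subgroup (↥(fixedField N) ≃ₐ[F] ↥(fixedField N)))
    (hH' : H.map (AlgEquiv.restrictNormalHom ↥(fixedField N)) = H') :
    IntermediateField.lift (fixedField H') = fixedField H := by
  have h1 := InfiniteGalois.restrict_fixedField H (fixedField N)
  rw [hH'] at h1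
  rw [← h1]
  exact inf_eq_left.mpr (IntermediateField.fixedField_le hNH)

omit [NumberField F] in
/-- Hence `M^{H̄} ≃ₐ[F] L^H`. [cite: MilneFT2022, Ch. 3 (fundamental theorem)] -/
private theorem nonempty_algEquiv_fixedField_of_map_restrictNormalHom₀ {L : Type} [Field L] [Algebra F L]
    [FiniteDimensional F L] [IsGalois F L] (N H : Subgroup (L ≃ₐ[F] L)) [N.Normal] (hNH : N ≤ H)
    (H' : Subgroup (↥(fixedField N) ≃ₐ[F] ↥(fixedField N)))
    (hH' : H.map (AlgEquiv.restrictNormalHom ↥(fixedField N)) = H') :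
    Nonempty (↥(fixedField H') ≃ₐ[F] ↥(fixedField H)) :=
  ⟨(IntermediateField.liftAlgEquiv (fixedField H')).trans
    (IntermediateField.equivOfEq (lift_fixedField_eq_of_map_restrictNormalHom₀ N H hNH H' hH'))⟩

/-- The cyclic subgroup generated by an involution `t` is `{1, t}`. [folklore] -/
private theorem mem_zpowers_iff_of_mul_self₀ {G : Type*} [Group G] {t x : G} (ht : t * t = 1) :
    x ∈ Subgroup.zpowers t ↔ x = 1 ∨ x = t := by
  have h2 : t ^ (2 : ℤ) = 1 := by rw [zpow_two]; exact ht
  constructor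
  · intro hx
    rw [Subgroup.mem_zpowers_iff] at hx
    obtain ⟨k, rfl⟩ := hx
    rcases Int.emod_two_eq_zero_or_one k with hk | hk
    · left
      rw [← Int.mul_ediv_add_emod k 2, zpow_add, zpow_mul, h2, one_zpow, one_mul, hk, zpow_zero]
    · right
      rw [← Int.mul_ediv_add_emod k 2, zpow_add, zpow_mul, h2, one_zpow, one_mul, hk, zpow_one]
  · intro hx
    rcases hx with hx | hx
    · rw [hx]; exact one_mem _
    · rw [hx]; exact Subgroup.mem_zpowers t

/-- `#⟨t⟩ = 2` for an involution `t ≠ 1`. [folklore] -/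
private theorem natCard_zpowers_of_mul_self {G : Type*} [Group G] {t : G} (ht : t * t = 1) (ht1 : t ≠ 1) :
    Nat.card ↥(Subgroup.zpowers t) = 2 := by
  rw [Nat.card_zpowers, orderOf_eq_prime (p := 2) (by rw [pow_two]; exact ht) ht1]

omit [NumberField F] in
/-- **`[L^H : F] = [G : H]`** for a finite Galois extension `L/F` with group `G` and `H ≤ G`
(`[L : L^H] = #H`, tower law, `#G = [L : F]`). [cite: MilneFT2022, Ch. 3 (fundamental theorem)] -/
theorem finrank_fixedField_eq_index {L : Type} [Field L] [Algebra F L] [FiniteDimensional F L] [IsGalois F L]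
    (H : Subgroup (L ≃ₐ[F] L)) : Module.finrank F ↥(fixedField H) = H.index := by
  have h1 : Module.finrank ↥(fixedField H) L = Nat.card H := IntermediateField.finrank_fixedField_eq_card H
  have h2 : Module.finrank F ↥(fixedField H) * Module.finrank ↥(fixedField H) L = Module.finrank F L :=
    Module.finrank_mul_finrank F ↥(fixedField H) L
  have h3 : Nat.card (L ≃ₐ[F] L) = Module.finrank F L := IsGalois.card_aut_eq_finrank F L
  have h4 : Nat.card H * H.index = Nat.card (L ≃ₐ[F] L) := Subgroup.card_mul_index H
  have hH : 0 < Nat.card H := Nat.card_pos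
  rw [h1] at h2
  have h5 : Nat.card H * H.index = Nat.card H * Module.finrank F ↥(fixedField H) := by
    rw [h4, h3, ← h2]; exact Nat.mul_comm _ _
  exact (Nat.eq_of_mul_eq_mul_left hH h5).symm

omit [NumberField F] in
/-- `L^{H₁} ≤ L^{⟨s⟩}` forces `s ∈ H₁` (finite Galois correspondence). [cite: MilneFT2022, Ch. 3 (fundamental theorem)] -/
theorem mem_of_fixedField_le_fixedField_zpowers {L : Type} [Field L] [Algebra F L] [FiniteDimensional F L]
    [IsGalois F L] {H : Subgroup (L ≃ₐ[F] L)} {s : L ≃ₐ[F] L}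
    (h : fixedField H ≤ fixedField (Subgroup.zpowers s)) : s ∈ H := by
  have h1 : Subgroup.zpowers s ≤ (fixedField H).fixingSubgroup := (IntermediateField.le_iff_le _ _).mp h
  rw [IntermediateField.fixingSubgroup_fixedField] at h1
  exact h1 (Subgroup.mem_zpowers s)

/-! ### §1 Klein four with three inputs (no conjugacy, no growth theorem, no named fact) -/

/-- **Klein descent, three inputs, hI-free and FW-free.**  `κ` cyclotomic over `F`, `p ≠ 2`, `L/F` finite Galois with `p ∤ [L : F]`,
`u, v ∈ Gal(L/F)` commuting involutions, `u ≠ v`, `u, v ≠ 1`; «`μ = 0` for every cyclotomic `ℤ_p`-extension» of each of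
`L^{⟨u⟩}`, `L^{⟨v⟩}`, `L^{⟨uv⟩}` ⟹ the same for `L` (norm relation `2 = N_⟨u⟩ + N_⟨v⟩ − u N_⟨uv⟩`, `p ∤ 2`).
[cite: BiasseEtAl2022, Example 2.5, Prop. 3.7] [cite: Washington1997, §13.1] -/
theorem classicalMuVanishes_of_isCyclotomic_of_klein_four_inputs' (hp2 : p ≠ 2)
    (L : Type) [Field L] [NumberField L] [Algebra F L] [IsGalois F L] (hp : ¬ p ∣ Module.finrank F L)
    {u v : L ≃ₐ[F] L} (hu : u * u = 1) (hv : v * v = 1) (huv : u * v = v * u) (hu1 : u ≠ 1) (hv1 : v ≠ 1)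
    (hne : u ≠ v)
    (hμu : ∀ κE : ZpExtension ↥(fixedField (Subgroup.zpowers u)) p, κE.IsCyclotomic → ClassicalMuVanishes κE)
    (hμv : ∀ κE : ZpExtension ↥(fixedField (Subgroup.zpowers v)) p, κE.IsCyclotomic → ClassicalMuVanishes κE)
    (hμuv : ∀ κE : ZpExtension ↥(fixedField (Subgroup.zpowers (u * v))) p,
      κE.IsCyclotomic → ClassicalMuVanishes κE)
    (κL : ZpExtension L p) (hκL : κL.IsCyclotomic) : ClassicalMuVanishes κL := by
  obtain ⟨κ, hκ⟩ := exists_cyclotomicZpExtension_holds F p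
  haveI : FiniteDimensional F L := Module.Finite.of_restrictScalars_finite ℚ F L
  have hL := surjective_comp_absGaloisRestrict_of_not_dvd_finrank κ L hp
  have hs : ∀ H : Subgroup (L ≃ₐ[F] L), Function.Surjective
      (κ.toContinuousMonoidHom.comp (absGaloisRestrict F ↥(fixedField H))) := fun H =>
    surjective_comp_absGaloisRestrict_of_not_dvd_finrank κ _ (not_dvd_finrank_intermediateField₀ hp (fixedField H))
  have h1 : ClassicalMuVanishes (κ.restrict L hL) :=
    classicalMuVanishes_restrict_of_klein_four' hp2 κ L hL hu hv huv hu1 hv1 hne (hs _) (hs _) (hs _)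
      (hμu _ (isCyclotomic_restrict κ hκ _ (hs _))) (hμv _ (isCyclotomic_restrict κ hκ _ (hs _)))
      (hμuv _ (isCyclotomic_restrict κ hκ _ (hs _)))
  exact (classicalMuVanishes_iff_of_isCyclotomic _ _ (isCyclotomic_restrict κ hκ L hL) hκL).mp h1

/-! ### §2 A Klein four in a quotient `Gal(L^N/F) = G/N` of order `4`, inputs from index-`2` subgroups of `G` -/

/-- **Quotient Klein descent.**  `L/F` finite Galois with group `G`, `p ≠ 2`, `p ∤ [L:F]`; `N ⊴ G` with `#N · 4 = #G`;
`a, b ∈ G` with `a², b², aba⁻¹b⁻¹ ∈ N` and `a, b, ab⁻¹ ∉ N` (so `Gal(L^N/F) = {1, ā, b̄, āb̄} ≅ C₂ × C₂`).  If `μ = 0` holds for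
every cyclotomic `ℤ_p`-extension of `L^{⟨b⟩}`, and of `L^H` for every subgroup `H ≥ N` of index `2` with `b ∉ H` (these are
`⟨N, a⟩` and `⟨N, ab⟩`, quadratic over `F` when `#G = 8`... in general of degree `2` over `F` iff `[G:H] = 2`), then `μ = 0` for every
cyclotomic `ℤ_p`-extension of `M = L^N`: Klein four `{1, ā, b̄, āb̄}` in `Gal(M/F)` with `M^{⟨ā⟩} ≅ L^{⟨N,a⟩}`, `M^{⟨āb̄⟩} ≅ L^{⟨N,ab⟩}`,
`M^{⟨b̄⟩} ≅ L^{⟨N,b⟩} ⊆ L^{⟨b⟩}` (`p`-prime index: `classicalMuVanishes_of_isCyclotomic_of_tower'`).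
[cite: Washington1997, §13.1] [cite: BiasseEtAl2022, Example 2.5, Prop. 3.7] [cite: MilneFT2022, Ch. 3 (fundamental theorem)] -/
theorem classicalMuVanishes_fixedField_of_quotient_klein' (hp2 : p ≠ 2)
    (L : Type) [Field L] [NumberField L] [Algebra F L] [IsGalois F L] (hp : ¬ p ∣ Module.finrank F L)
    (N : Subgroup (L ≃ₐ[F] L)) [N.Normal] (hN : Nat.card ↥N * 4 = Nat.card (L ≃ₐ[F] L))
    {a b : L ≃ₐ[F] L} (ha2 : a * a ∈ N) (hb2 : b * b ∈ N) (hab : a * b * a⁻¹ * b⁻¹ ∈ N)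
    (haN : a ∉ N) (hbN : b ∉ N) (habN : a * b⁻¹ ∉ N)
    (hμb : ∀ κE : ZpExtension ↥(fixedField (Subgroup.zpowers b)) p, κE.IsCyclotomic → ClassicalMuVanishes κE)
    (hquad : ∀ H : Subgroup (L ≃ₐ[F] L), N ≤ H → H.index = 2 → b ∉ H →
      ∀ κE : ZpExtension ↥(fixedField H) p, κE.IsCyclotomic → ClassicalMuVanishes κE) :
    ∀ κM : ZpExtension ↥(fixedField N) p, κM.IsCyclotomic → ClassicalMuVanishes κM := by
  classical
  obtain ⟨κ, hκ⟩ := exists_cyclotomicZpExtension_holds F p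
  haveI : FiniteDimensional F L := Module.Finite.of_restrictScalars_finite ℚ F L
  set M : IntermediateField F L := fixedField N with hM
  haveI : IsGalois F ↥M := IsGalois.of_fixedField_normal_subgroup N
  set π : (L ≃ₐ[F] L) →* (↥M ≃ₐ[F] ↥M) := AlgEquiv.restrictNormalHom ↥M with hπ
  have hπsurj : Function.Surjective π := AlgEquiv.restrictNormalHom_surjective L
  have hker : π.ker = N := by
    have h1 := IntermediateField.restrictNormalHom_ker (K := F) (L := L) (fixedField N)
    rw [IntermediateField.fixingSubgroup_fixedField] at h1
    exact h1
  have hπ1 : ∀ g : L ≃ₐ[F] L, π g = 1 ↔ g ∈ N := fun g => by rw [← MonoidHom.mem_ker, hker]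
  -- the Klein four `{1, ā, b̄, ā b̄}` in `Gal(M/F)`
  have hu : π a * π a = 1 := by rw [← map_mul, (hπ1 _).mpr ha2]
  have hv : π b * π b = 1 := by rw [← map_mul, (hπ1 _).mpr hb2]
  have huv : π a * π b = π b * π a := by
    have h1 : π (a * b * a⁻¹ * b⁻¹) = 1 := (hπ1 _).mpr hab
    rw [map_mul, map_mul, map_mul, map_inv, map_inv, mul_inv_eq_one, mul_inv_eq_iff_eq_mul] at h1
    exact h1
  have hu1 : π a ≠ 1 := fun h => haN ((hπ1 a).mp h)
  have hv1 : π b ≠ 1 := fun h => hbN ((hπ1 b).mp h)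
  have hne : π a ≠ π b := fun h => habN ((hπ1 _).mp (by rw [map_mul, map_inv, h, mul_inv_cancel]))
  have huv1 : π a * π b ≠ 1 := fun h => hne (by
    have := congrArg (· * π b) h
    simpa only [mul_assoc, hv, mul_one, one_mul] using this)
  -- `#Gal(M/F) = 4`, so `⟨ā⟩` and `⟨ā b̄⟩` have index `2`
  have hcardM : Nat.card (↥M ≃ₐ[F] ↥M) = 4 := by
    have h1 : N.index = Nat.card (↥M ≃ₐ[F] ↥M) := by
      rw [← hker, Subgroup.index_ker, MonoidHom.range_eq_top_of_surjective π hπsurj, Subgroup.card_top]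
    have h2 : Nat.card ↥N * N.index = Nat.card (L ≃ₐ[F] L) := Subgroup.card_mul_index N
    have hNpos : 0 < Nat.card ↥N := Nat.card_pos
    rw [← hN] at h2
    rw [← h1]
    exact (Nat.eq_of_mul_eq_mul_left hNpos h2)
  have hidx : ∀ {t : ↥M ≃ₐ[F] ↥M}, t * t = 1 → t ≠ 1 → (Subgroup.zpowers t).index = 2 := by
    intro t ht ht1
    have h1 : Nat.card ↥(Subgroup.zpowers t) * (Subgroup.zpowers t).index = 4 := by
      rw [Subgroup.card_mul_index, hcardM]
    rw [natCard_zpowers_of_mul_self ht ht1] at h1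
    omega
  -- the index-2 subgroups `H_a = π⁻¹⟨ā⟩`, `H_ab = π⁻¹⟨ā b̄⟩` of `G`
  have hHidx : ∀ {t : ↥M ≃ₐ[F] ↥M}, t * t = 1 → t ≠ 1 → ((Subgroup.zpowers t).comap π).index = 2 :=
    fun {t} ht ht1 => (Subgroup.index_comap_of_surjective (H := Subgroup.zpowers t) (f := π) hπsurj).trans (hidx ht ht1)
  have hNle : ∀ t : ↥M ≃ₐ[F] ↥M, N ≤ (Subgroup.zpowers t).comap π := fun t => by
    rw [← hker]; exact MonoidHom.ker_le_comap π _
  have hmap : ∀ t : ↥M ≃ₐ[F] ↥M, ((Subgroup.zpowers t).comap π).map π = Subgroup.zpowers t := fun t =>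
    Subgroup.map_comap_eq_self_of_surjective hπsurj _
  -- input for `M^{⟨ā⟩}`
  have hbHa : b ∉ (Subgroup.zpowers (π a)).comap π := by
    rw [Subgroup.mem_comap, mem_zpowers_iff_of_mul_self₀ hu]
    rintro (h | h)
    · exact hv1 h
    · exact hne h.symm
  obtain ⟨ea⟩ := nonempty_algEquiv_fixedField_of_map_restrictNormalHom₀ (F := F) N _ (hNle (π a)) _ (hmap (π a))
  have hμu : ∀ κE : ZpExtension ↥(fixedField (Subgroup.zpowers (π a))) p, κE.IsCyclotomic → ClassicalMuVanishes κE :=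
    forall_classicalMuVanishes_of_algEquiv ea.symm (not_dvd_finrank_intermediateField₀ hp _)
      (hquad _ (hNle (π a)) (hHidx hu hu1) hbHa)
  -- input for `M^{⟨ā b̄⟩}`
  have huvuv : (π a * π b) * (π a * π b) = 1 := by
    calc (π a * π b) * (π a * π b) = π a * (π b * π a) * π b := by group
      _ = π a * (π a * π b) * π b := by rw [huv]
      _ = (π a * π a) * (π b * π b) := by group
      _ = 1 := by rw [hu, hv, one_mul]
  have hbHab : b ∉ (Subgroup.zpowers (π a * π b)).comap π := by
    rw [Subgroup.mem_comap, mem_zpowers_iff_of_mul_self₀ huvuv]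
    rintro (h | h)
    · exact hv1 h
    · apply hu1
      have := congrArg (· * π b) h
      simpa only [mul_assoc, hv, mul_one] using this.symm
  obtain ⟨eab⟩ := nonempty_algEquiv_fixedField_of_map_restrictNormalHom₀ (F := F) N _ (hNle (π a * π b)) _
    (hmap (π a * π b))
  have hμuv : ∀ κE : ZpExtension ↥(fixedField (Subgroup.zpowers (π a * π b))) p,
      κE.IsCyclotomic → ClassicalMuVanishes κE :=
    forall_classicalMuVanishes_of_algEquiv eab.symm (not_dvd_finrank_intermediateField₀ hp _)
      (hquad _ (hNle _) (hHidx huvuv huv1) hbHab)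
  -- input for `M^{⟨b̄⟩} ≅ L^{π⁻¹⟨b̄⟩} ⊆ L^{⟨b⟩}`
  set Hb : Subgroup (L ≃ₐ[F] L) := (Subgroup.zpowers (π b)).comap π with hHb
  have hle : fixedField Hb ≤ fixedField (Subgroup.zpowers b) :=
    IntermediateField.fixedField_le ((Subgroup.zpowers_le).mpr (by
      rw [hHb, Subgroup.mem_comap]; exact Subgroup.mem_zpowers _))
  have hμHb : ∀ κK : ZpExtension ↥(fixedField Hb) p, κK.IsCyclotomic → ClassicalMuVanishes κK := by
    letI : Algebra ↥(fixedField Hb) ↥(fixedField (Subgroup.zpowers b)) :=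
      (IntermediateField.inclusion hle).toRingHom.toAlgebra
    haveI : IsScalarTower F ↥(fixedField Hb) ↥(fixedField (Subgroup.zpowers b)) :=
      IsScalarTower.of_algebraMap_eq fun _ => rfl
    exact classicalMuVanishes_of_isCyclotomic_of_tower' κ hκ ↥(fixedField Hb) ↥(fixedField (Subgroup.zpowers b))
      (not_dvd_finrank_intermediateField₀ hp _) hμb
  obtain ⟨eb⟩ := nonempty_algEquiv_fixedField_of_map_restrictNormalHom₀ (F := F) N Hb (hNle (π b)) _ (hmap (π b))
  have hμv : ∀ κE : ZpExtension ↥(fixedField (Subgroup.zpowers (π b))) p, κE.IsCyclotomic → ClassicalMuVanishes κE :=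
    forall_classicalMuVanishes_of_algEquiv eb.symm (not_dvd_finrank_intermediateField₀ hp _) hμHb
  -- Klein with three inputs in `Gal(M/F)`
  have hpM : ¬ p ∣ Module.finrank F ↥M := not_dvd_finrank_intermediateField₀ hp M
  exact classicalMuVanishes_of_isCyclotomic_of_klein_four_inputs' hp2 ↥M hpM hu hv huv hu1 hv1 hne hμu hμv hμuv

/-! ### §3 The `D₄ = N_s(3)` census form over `ℚ`, Ferrero–Washington-free -/

/-- **`D₄` shape over `ℚ`, FW-free: `μ(L) = 0 ⟸ μ(L^{⟨b⟩}) = 0 ∧ μ(L^H) = 0` for the index-`2` subgroups `H ∌ b`.**  `L/ℚ` finite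
Galois with `#Gal(L/ℚ) = 8`, `p` odd, `p ∤ [L:ℚ]`; `z` a central involution, `b ≠ 1, z` an involution commuting with `z`, `g` with
`g b g⁻¹ = z b` and `g² ∈ ⟨z⟩` (for `L = ℚ(E[3])` with image `C_s⁺(3) ≅ D₄`: `z = −1`, `b = s` fixing `P`, `g` any element not
commuting with `s`).  If `μ = 0` (growth form) holds for every cyclotomic `ℤ_p`-extension of `L^{⟨b⟩}` (`= ℚ(P)`) and of `L^H` for
every subgroup `H` of index `2` with `b ∉ H` (the two quadratic subfields not inside `L^{⟨b⟩}`; for `b` = complex conjugation: the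
imaginary quadratic subfields), then for every cyclotomic `ℤ_p`-extension of `L`.  NO named fact (replaces the Ferrero–Washington inputs
of `classicalMuVanishes_of_isCyclotomic_of_kuroda_rat` / `…_klein_four_rat'`).  Road: §2 with `N = ⟨z⟩` gives `μ(L^{⟨z⟩}) = 0`, then the
Klein four `{1, z, b, zb}` with `zb = g b g⁻¹`. [cite: Washington1997, §13.1, §7.5] [cite: BiasseEtAl2022, Example 2.5, Prop. 3.7]
[cite: Serre1972, §2.2 (split Cartan subgroups, normalisers)] -/
theorem classicalMuVanishes_of_isCyclotomic_of_dihedral_rat_of_quadratic (hp2 : p ≠ 2)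
    (L : Type) [Field L] [NumberField L] [IsGalois ℚ L] (hp : ¬ p ∣ Module.finrank ℚ L)
    (hcard : Nat.card (L ≃ₐ[ℚ] L) = 8)
    {z b g : L ≃ₐ[ℚ] L} (hz : z * z = 1) (hb : b * b = 1) (hz1 : z ≠ 1) (hb1 : b ≠ 1) (hbz : b ≠ z)
    (hzc : ∀ x : L ≃ₐ[ℚ] L, x * z = z * x) (hg : g * b * g⁻¹ = z * b) (hgg : g * g ∈ Subgroup.zpowers z)
    (hμb : ∀ κE : ZpExtension ↥(fixedField (Subgroup.zpowers b)) p, κE.IsCyclotomic → ClassicalMuVanishes κE)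
    (hquad : ∀ H : Subgroup (L ≃ₐ[ℚ] L), H.index = 2 → b ∉ H →
      ∀ κE : ZpExtension ↥(fixedField H) p, κE.IsCyclotomic → ClassicalMuVanishes κE)
    (κL : ZpExtension L p) (hκL : κL.IsCyclotomic) : ClassicalMuVanishes κL := by
  obtain ⟨κ, hκ⟩ := exists_cyclotomicZpExtension_holds ℚ p
  haveI hzN : (Subgroup.zpowers z).Normal := by
    refine ⟨fun h hh x => ?_⟩
    rw [mem_zpowers_iff_of_mul_self₀ hz] at hh
    rcases hh with hh | hh <;> rw [hh]
    · rw [mul_one, mul_inv_cancel]; exact one_mem _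
    · rw [hzc x, mul_assoc, mul_inv_cancel, mul_one]; exact Subgroup.mem_zpowers z
  have hmem : ∀ x : L ≃ₐ[ℚ] L, x ∈ Subgroup.zpowers z ↔ x = 1 ∨ x = z := fun x => mem_zpowers_iff_of_mul_self₀ hz
  have hgb : g * b = z * b * g := by
    calc g * b = g * b * g⁻¹ * g := by group
      _ = z * b * g := by rw [hg]
  -- Step 1: `μ(L^{⟨z⟩}) = 0` by §2 with `N = ⟨z⟩`, `a = g`
  have hN : Nat.card ↥(Subgroup.zpowers z) * 4 = Nat.card (L ≃ₐ[ℚ] L) := by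
    rw [natCard_zpowers_of_mul_self hz hz1, hcard]
  have hb2 : b * b ∈ Subgroup.zpowers z := by rw [hb]; exact one_mem _
  have hab : g * b * g⁻¹ * b⁻¹ ∈ Subgroup.zpowers z := by
    rw [hg, mul_assoc, mul_inv_cancel, mul_one]; exact Subgroup.mem_zpowers z
  have hbinv : b⁻¹ = b := inv_eq_of_mul_eq_one_right hb
  have hzbz : z * b * z⁻¹ = b := by rw [← hzc b, mul_assoc, mul_inv_cancel, mul_one]
  have hgN : g ∉ Subgroup.zpowers z := by
    rw [hmem]
    rintro (h | h)
    · apply hz1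
      have h2 : (1 : L ≃ₐ[ℚ] L) * b = z * b := by rw [one_mul, ← hg, h, one_mul, inv_one, mul_one]
      exact (mul_right_cancel h2).symm
    · apply hz1
      have h2 : (1 : L ≃ₐ[ℚ] L) * b = z * b := by rw [one_mul, ← hg, h, hzbz]
      exact (mul_right_cancel h2).symm
  have hbN : b ∉ Subgroup.zpowers z := by
    rw [hmem]; rintro (h | h); exacts [hb1 h, hbz h]
  have hgbN : g * b⁻¹ ∉ Subgroup.zpowers z := by
    rw [hmem, hbinv]
    rintro (h | h)
    · -- `g b = 1` ⟹ `g = b` ⟹ `z = 1`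
      have hgb' : g = b := (eq_inv_of_mul_eq_one_left h).trans hbinv
      apply hz1
      have h2 : (1 : L ≃ₐ[ℚ] L) * b = z * b := by
        rw [one_mul, ← hg, hgb', hbinv, mul_assoc, hb, mul_one]
      exact (mul_right_cancel h2).symm
    · -- `g b = z` ⟹ `g = z b` ⟹ `z = 1`
      have hgzb : g = z * b := (eq_mul_inv_of_mul_eq h).trans (by rw [hbinv])
      apply hz1
      have h3 : z * b * b * (z * b)⁻¹ = b := by
        rw [mul_inv_rev, hbinv, mul_assoc z b b, hb, mul_one, ← mul_assoc, hzbz]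
      have h2 : (1 : L ≃ₐ[ℚ] L) * b = z * b := by rw [one_mul, ← hg, hgzb, h3]
      exact (mul_right_cancel h2).symm
  have hμM : ∀ κM : ZpExtension ↥(fixedField (Subgroup.zpowers z)) p, κM.IsCyclotomic → ClassicalMuVanishes κM :=
    classicalMuVanishes_fixedField_of_quotient_klein' hp2 L hp (Subgroup.zpowers z) hN hgg hb2 hab hgN hbN hgbN hμb
      (fun H _ hH hbH => hquad H hH hbH)
  -- Step 2: Klein four `{1, z, b, zb}` in `G`, `zb = g b g⁻¹`
  have hzb : z * b = b * z := (hzc b).symm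
  exact classicalMuVanishes_of_isCyclotomic_of_klein_four' hp2 κ hκ L hp hz hb hzb hz1 hb1 hbz.symm ⟨g, hg⟩ hμM hμb κL hκL

/-! ### §4 The `SD₁₆ = N_ns(3)` census form over `ℚ`, Ferrero–Washington-free -/

/-- **`SD₁₆` shape over `ℚ`, FW-free: `μ(L) = 0 ⟸ μ(L^{⟨s⟩}) = 0 ∧ μ(L^H) = 0` for the index-`2` subgroups `H ∌ s`.**  `L/ℚ` finite
Galois with `#Gal(L/ℚ) = 16`, `p` odd, `p ∤ [L : ℚ]`; `w, s, g ∈ Gal(L/ℚ)` with `z = w²` central, `z² = 1 ≠ z`, `s² = 1`, `s ∉ {1, z}`,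
`s w s⁻¹ = w⁻¹`, `w ∉ {s, zs}`, `g s g⁻¹ = w³ s`, `g² ∈ ⟨w⟩`, `g, gs ∉ ⟨w⟩`, and `⟨w⟩ ⊇ [G, G]` (for `L = ℚ(E[3])` with image
`C_ns⁺(3) = ⟨r, s⟩ ≅ SD₁₆`: `w = r²`, `g = r`, `z = −1`; `L^{⟨s⟩} = ℚ(P)`).  If `μ = 0` holds for every cyclotomic `ℤ_p`-extension of
`L^{⟨s⟩}` and of `L^H` for every index-`2` subgroup `H` with `s ∉ H` (`⟨r⟩` and `⟨r², rs⟩`; for `s` = complex conjugation: the imaginary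
quadratic subfields `ℚ(√−3)` and `K⁻`), then for every cyclotomic `ℤ_p`-extension of `L`.  NO named fact (replaces the Ferrero–Washington
input of `classicalMuVanishes_of_isCyclotomic_of_semidihedral_rat'`: the biquadratic `L^{⟨w⟩}` is handled by §2 with `N = ⟨w⟩`, `a = g`).
[cite: Washington1997, §13.1, §7.5] [cite: BiasseEtAl2022, Example 2.5, Prop. 3.7] [cite: Serre1972, §2.2 (non-split Cartan subgroups and
their normalisers)] [cite: MilneFT2022, Ch. 3] -/
theorem classicalMuVanishes_of_isCyclotomic_of_semidihedral_rat_of_quadratic (hp2 : p ≠ 2)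
    (L : Type) [Field L] [NumberField L] [IsGalois ℚ L] (hp : ¬ p ∣ Module.finrank ℚ L)
    (hcard : Nat.card (L ≃ₐ[ℚ] L) = 16)
    {w s g : L ≃ₐ[ℚ] L} (hzc : ∀ x : L ≃ₐ[ℚ] L, x * (w * w) = (w * w) * x) (hz4 : (w * w) * (w * w) = 1)
    (hz1 : w * w ≠ 1) (hs : s * s = 1) (hs1 : s ≠ 1) (hsz : s ≠ w * w) (hdih : s * w * s⁻¹ = w⁻¹)
    (hws : w ≠ s) (hwzs : w ≠ w * w * s) (hg : g * s * g⁻¹ = w * w * w * s) (hgg : g * g ∈ Subgroup.zpowers w)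
    (hgw : g ∉ Subgroup.zpowers w) (hgs : g * s ∉ Subgroup.zpowers w)
    (hcomm : ∀ a b : L ≃ₐ[ℚ] L, a * b * a⁻¹ * b⁻¹ ∈ Subgroup.zpowers w)
    (hμs : ∀ κE : ZpExtension ↥(fixedField (Subgroup.zpowers s)) p, κE.IsCyclotomic → ClassicalMuVanishes κE)
    (hquad : ∀ H : Subgroup (L ≃ₐ[ℚ] L), H.index = 2 → s ∉ H →
      ∀ κE : ZpExtension ↥(fixedField H) p, κE.IsCyclotomic → ClassicalMuVanishes κE)
    (κL : ZpExtension L p) (hκL : κL.IsCyclotomic) : ClassicalMuVanishes κL := by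
  obtain ⟨κ, hκ⟩ := exists_cyclotomicZpExtension_holds ℚ p
  set z : L ≃ₐ[ℚ] L := w * w with hz
  have hwinv : w⁻¹ = w * z := inv_eq_of_mul_eq_one_right (by rw [← mul_assoc, ← hz]; exact hz4)
  have hsw : s * w = w * z * s := by
    have h1 : s * w = w⁻¹ * s := by
      calc s * w = s * w * s⁻¹ * s := by group
        _ = w⁻¹ * s := by rw [hdih]
    rw [h1, hwinv]
  have hconj₁ : w * s * w⁻¹ = z * s := by
    have h1 : s * w⁻¹ * s⁻¹ = w := by
      have := congrArg (·⁻¹) hdih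
      simpa only [mul_inv_rev, inv_inv, ← mul_assoc] using this
    calc w * s * w⁻¹ = w * (s * w⁻¹ * s⁻¹) * s := by group
      _ = z * s := by rw [h1, ← hz]
  haveI hzN : (Subgroup.zpowers z).Normal := by
    refine ⟨fun h hh a => ?_⟩
    rw [mem_zpowers_iff_of_mul_self₀ hz4] at hh
    rcases hh with hh | hh <;> rw [hh]
    · rw [mul_one, mul_inv_cancel]; exact one_mem _
    · rw [hzc a, mul_assoc, mul_inv_cancel, mul_one]; exact Subgroup.mem_zpowers z
  haveI hwN : (Subgroup.zpowers w).Normal := by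
    refine ⟨fun h hh a => ?_⟩
    have h1 : a * h * a⁻¹ * h⁻¹ ∈ Subgroup.zpowers w := hcomm a h
    have h2 : a * h * a⁻¹ = (a * h * a⁻¹ * h⁻¹) * h := by group
    rw [h2]
    exact Subgroup.mul_mem _ h1 hh
  -- Step 0 (replaces Ferrero–Washington): `μ(L^{⟨w⟩}) = 0` by §2 with `N = ⟨w⟩`, `a = g`, `b = s`
  have hw4 : Nat.card ↥(Subgroup.zpowers w) = 4 := by
    rw [Nat.card_zpowers]
    have h := orderOf_eq_prime_pow (p := 2) (n := 1) (x := w) (by rw [pow_one, pow_two]; exact hz1)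
      (by rw [show (2 : ℕ) ^ (1 + 1) = 4 by norm_num, show w ^ 4 = (w * w) * (w * w) by simp [pow_succ, mul_assoc]]
          exact hz4)
    rw [h]; norm_num
  have hN : Nat.card ↥(Subgroup.zpowers w) * 4 = Nat.card (L ≃ₐ[ℚ] L) := by rw [hw4, hcard]
  have hs2w : s * s ∈ Subgroup.zpowers w := by rw [hs]; exact one_mem _
  have hsNw : s ∉ Subgroup.zpowers w := by
    intro h
    -- `s ∈ ⟨w⟩` commutes with `w`, so `w⁻¹ = s w s⁻¹ = w`, i.e. `w² = 1`
    obtain ⟨k, rfl⟩ := Subgroup.mem_zpowers_iff.mp h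
    apply hz1
    have h1 : (w ^ k) * w * (w ^ k)⁻¹ = w := by rw [← zpow_one w, ← zpow_mul, ← zpow_add, ← zpow_neg]; group
    rw [h1] at hdih
    -- `w = w⁻¹`
    calc w * w = w * w⁻¹ := by rw [← hdih]
      _ = 1 := mul_inv_cancel w
  have hgsN : g * s⁻¹ ∉ Subgroup.zpowers w := by
    rw [inv_eq_of_mul_eq_one_right hs]; exact hgs
  have hμB : ∀ κB : ZpExtension ↥(fixedField (Subgroup.zpowers w)) p, κB.IsCyclotomic → ClassicalMuVanishes κB :=
    classicalMuVanishes_fixedField_of_quotient_klein' hp2 L hp (Subgroup.zpowers w) hN hgg hs2w (hcomm g s) hgw hsNw hgsN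
      hμs (fun H _ hH hsH => hquad H hH hsH)
  -- from here on: the proof of `…_semidihedral_rat'`, with `hμB` transported to `M^{⟨w̄⟩}` in place of Ferrero–Washington
  set M : IntermediateField ℚ L := fixedField (Subgroup.zpowers z) with hM
  haveI : IsGalois ℚ ↥M := IsGalois.of_fixedField_normal_subgroup (Subgroup.zpowers z)
  set π : (L ≃ₐ[ℚ] L) →* (↥M ≃ₐ[ℚ] ↥M) := AlgEquiv.restrictNormalHom ↥M with hπ
  have hker : π.ker = Subgroup.zpowers z := by
    have h1 := IntermediateField.restrictNormalHom_ker (K := ℚ) (L := L) (fixedField (Subgroup.zpowers z))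
    rw [IntermediateField.fixingSubgroup_fixedField] at h1
    exact h1
  have hπker : ∀ x : L ≃ₐ[ℚ] L, π x = 1 ↔ x = 1 ∨ x = z := by
    intro x
    rw [← MonoidHom.mem_ker, hker, mem_zpowers_iff_of_mul_self₀ hz4]
  have hπz : π z = 1 := (hπker z).mpr (Or.inr rfl)
  have hu : π w * π w = 1 := by rw [← map_mul, ← hz, hπz]
  have hv : π s * π s = 1 := by rw [← map_mul, hs, map_one]
  have huv : π w * π s = π s * π w := by
    rw [← map_mul, ← map_mul, hsw, map_mul, map_mul, map_mul, hπz, mul_one]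
  have hu1 : π w ≠ 1 := by
    intro h
    rcases (hπker w).mp h with h1 | h1
    · exact hz1 (by rw [hz, h1, one_mul])
    · apply hz1
      calc z = w * w := hz
        _ = z * z := by rw [h1]
        _ = 1 := hz4
  have hv1 : π s ≠ 1 := by
    intro h
    rcases (hπker s).mp h with h1 | h1
    · exact hs1 h1
    · exact hsz h1
  have hne : π w ≠ π s := by
    intro h
    have h1 : π (w * s⁻¹) = 1 := by rw [map_mul, map_inv, h, mul_inv_cancel]
    rcases (hπker _).mp h1 with h2 | h2
    · exact hws (by simpa using congrArg (· * s) h2)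
    · exact hwzs (by simpa using congrArg (· * s) h2)
  have hconj₂ : ∃ x : ↥M ≃ₐ[ℚ] ↥M, x * π s * x⁻¹ = π w * π s := by
    refine ⟨π g, ?_⟩
    rw [← map_inv, ← map_mul, ← map_mul, hg, map_mul, map_mul, hπz, one_mul]
  have hπw : (Subgroup.zpowers w).map π = Subgroup.zpowers (π w) := MonoidHom.map_zpowers π w
  -- `M^{⟨w̄⟩} ≅ L^{⟨w⟩}`: the biquadratic input, now a theorem
  have hzw : Subgroup.zpowers z ≤ Subgroup.zpowers w := by
    rw [Subgroup.zpowers_le, hz]; exact Subgroup.mul_mem _ (Subgroup.mem_zpowers w) (Subgroup.mem_zpowers w)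
  obtain ⟨eW⟩ := nonempty_algEquiv_fixedField_of_map_restrictNormalHom₀ (F := ℚ) (Subgroup.zpowers z)
    (Subgroup.zpowers w) hzw (Subgroup.zpowers (π w)) hπw
  have hμu : ∀ κE : ZpExtension ↥(fixedField (Subgroup.zpowers (π w))) p, κE.IsCyclotomic → ClassicalMuVanishes κE :=
    forall_classicalMuVanishes_of_algEquiv eW.symm (not_dvd_finrank_intermediateField₀ hp _) hμB
  -- `M^{⟨s̄⟩} ≅ L^{⟨s, z⟩} ⊆ L^{⟨s⟩}`
  set Hs : Subgroup (L ≃ₐ[ℚ] L) := Subgroup.zpowers s ⊔ Subgroup.zpowers z with hHs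
  have hπs : Hs.map π = Subgroup.zpowers (π s) := by
    rw [hHs, Subgroup.map_sup, MonoidHom.map_zpowers, MonoidHom.map_zpowers, hπz, Subgroup.zpowers_one_eq_bot,
      sup_bot_eq]
  obtain ⟨eS⟩ := nonempty_algEquiv_fixedField_of_map_restrictNormalHom₀ (F := ℚ) (Subgroup.zpowers z) Hs le_sup_right
    (Subgroup.zpowers (π s)) hπs
  have hle : fixedField Hs ≤ fixedField (Subgroup.zpowers s) := IntermediateField.fixedField_le le_sup_left
  have hμHs : ∀ κK : ZpExtension ↥(fixedField Hs) p, κK.IsCyclotomic → ClassicalMuVanishes κK := by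
    letI : Algebra ↥(fixedField Hs) ↥(fixedField (Subgroup.zpowers s)) :=
      (IntermediateField.inclusion hle).toRingHom.toAlgebra
    haveI : IsScalarTower ℚ ↥(fixedField Hs) ↥(fixedField (Subgroup.zpowers s)) :=
      IsScalarTower.of_algebraMap_eq fun _ => rfl
    exact classicalMuVanishes_of_isCyclotomic_of_tower' κ hκ ↥(fixedField Hs) ↥(fixedField (Subgroup.zpowers s))
      (not_dvd_finrank_intermediateField₀ hp _) hμs
  have hμv : ∀ κE : ZpExtension ↥(fixedField (Subgroup.zpowers (π s))) p, κE.IsCyclotomic → ClassicalMuVanishes κE :=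
    forall_classicalMuVanishes_of_algEquiv eS.symm (not_dvd_finrank_intermediateField₀ hp _) hμHs
  have hpM : ¬ p ∣ Module.finrank ℚ ↥M := not_dvd_finrank_intermediateField₀ hp M
  have hμM : ∀ κM : ZpExtension ↥M p, κM.IsCyclotomic → ClassicalMuVanishes κM :=
    classicalMuVanishes_of_isCyclotomic_of_klein_four' hp2 κ hκ ↥M hpM hu hv huv hu1 hv1 hne hconj₂ hμu hμv
  have hzs : z * s = s * z := (hzc s).symm
  have hzs_ne : z ≠ s := fun h => hsz h.symm
  exact classicalMuVanishes_of_isCyclotomic_of_klein_four' hp2 κ hκ L hp hz4 hs hzs hz1 hs1 hzs_ne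
    ⟨w, hconj₁⟩ hμM hμs κL hκL

/-! ### §5 Degenerate (abelian) images: `Gal(L/ℚ) = {1, s}` and `{1, s, x, xs}` -/

/-- **`#Gal(L/ℚ) = 2`** (`L` quadratic, `L^{⟨s⟩} = ℚ`): the index-`2` input at `H = 1` (`s ∉ 1`) is `μ(L) = 0` itself.
[cite: Washington1997, §13.1] -/
theorem classicalMuVanishes_of_isCyclotomic_of_card_two_of_quadratic
    (L : Type) [Field L] [NumberField L] [IsGalois ℚ L] (hp : ¬ p ∣ Module.finrank ℚ L)
    (hcard : Nat.card (L ≃ₐ[ℚ] L) = 2) {s : L ≃ₐ[ℚ] L} (hs1 : s ≠ 1)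
    (hquad : ∀ H : Subgroup (L ≃ₐ[ℚ] L), H.index = 2 → s ∉ H →
      ∀ κE : ZpExtension ↥(fixedField H) p, κE.IsCyclotomic → ClassicalMuVanishes κE)
    (κL : ZpExtension L p) (hκL : κL.IsCyclotomic) : ClassicalMuVanishes κL := by
  have h1 : (⊥ : Subgroup (L ≃ₐ[ℚ] L)).index = 2 := by rw [Subgroup.index_bot, hcard]
  have h2 : s ∉ (⊥ : Subgroup (L ≃ₐ[ℚ] L)) := fun h => hs1 (Subgroup.mem_bot.mp h)
  have hμ := hquad ⊥ h1 h2
  have e : ↥(fixedField (⊥ : Subgroup (L ≃ₐ[ℚ] L))) ≃ₐ[ℚ] L :=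
    (IntermediateField.equivOfEq (fixedField_bot (F := ℚ) (E := L))).trans IntermediateField.topEquiv
  exact forall_classicalMuVanishes_of_algEquiv e (not_dvd_finrank_intermediateField₀ hp _) hμ κL hκL

/-- **`#Gal(L/ℚ) = 4` with two commuting involutions `x ≠ s`** (`L` biquadratic): `μ(L) = 0` from `μ(L^{⟨s⟩}) = 0` and the index-`2`
inputs at `H = ⟨x⟩`, `⟨xs⟩` (§2 with `N = 1`). [cite: Washington1997, §13.1] [cite: BiasseEtAl2022, Example 2.5, Prop. 3.7] -/
theorem classicalMuVanishes_of_isCyclotomic_of_card_four_of_quadratic (hp2 : p ≠ 2)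
    (L : Type) [Field L] [NumberField L] [IsGalois ℚ L] (hp : ¬ p ∣ Module.finrank ℚ L)
    (hcard : Nat.card (L ≃ₐ[ℚ] L) = 4) {x s : L ≃ₐ[ℚ] L} (hx : x * x = 1) (hs : s * s = 1) (hxs : x * s = s * x)
    (hx1 : x ≠ 1) (hs1 : s ≠ 1) (hne : x ≠ s)
    (hμs : ∀ κE : ZpExtension ↥(fixedField (Subgroup.zpowers s)) p, κE.IsCyclotomic → ClassicalMuVanishes κE)
    (hquad : ∀ H : Subgroup (L ≃ₐ[ℚ] L), H.index = 2 → s ∉ H →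
      ∀ κE : ZpExtension ↥(fixedField H) p, κE.IsCyclotomic → ClassicalMuVanishes κE)
    (κL : ZpExtension L p) (hκL : κL.IsCyclotomic) : ClassicalMuVanishes κL := by
  have hN : Nat.card ↥(⊥ : Subgroup (L ≃ₐ[ℚ] L)) * 4 = Nat.card (L ≃ₐ[ℚ] L) := by
    rw [Subgroup.card_bot, hcard]
  have hab : x * s * x⁻¹ * s⁻¹ ∈ (⊥ : Subgroup (L ≃ₐ[ℚ] L)) := by
    rw [hxs, Subgroup.mem_bot]; group
  have hxsN : x * s⁻¹ ∉ (⊥ : Subgroup (L ≃ₐ[ℚ] L)) := by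
    rw [Subgroup.mem_bot, inv_eq_of_mul_eq_one_right hs]
    intro h
    apply hne
    simpa [hs, mul_assoc] using congrArg (· * s) h
  have hμ := classicalMuVanishes_fixedField_of_quotient_klein' hp2 L hp (⊥ : Subgroup (L ≃ₐ[ℚ] L)) hN
    (by rw [hx]; exact one_mem _) (by rw [hs]; exact one_mem _) hab (fun h => hx1 (Subgroup.mem_bot.mp h))
    (fun h => hs1 (Subgroup.mem_bot.mp h)) hxsN hμs (fun H _ hH hsH => hquad H hH hsH)
  have e : ↥(fixedField (⊥ : Subgroup (L ≃ₐ[ℚ] L))) ≃ₐ[ℚ] L :=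
    (IntermediateField.equivOfEq (fixedField_bot (F := ℚ) (E := L))).trans IntermediateField.topEquiv
  exact forall_classicalMuVanishes_of_algEquiv e (not_dvd_finrank_intermediateField₀ hp _) hμ κL hκL

end Literature.NumberTheory.IwasawaTheory

end
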